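import Literature.Probability.TransportMaps.DobrushinCouplingCompact
import Literature.Probability.LatticeModels.DobrushinMetricStates
import Literature.Probability.LatticeModels.GibbsExistenceCompact
import HarnessLib

/-!
# Dobrushin's coupling setup for DLR Gibbs measures of a Georgii specification: the one-site
# kernels `γ_{x}` as Markov kernels, resampling invariance of `μ ∈ 𝒢(γ)` and of `γ_Λ(·|η)`, and
# `OneSiteKernels` for two Gibbs measures

[topic Probability/TransportMaps]

[Georgii2011] H.-O. Georgii, *Gibbs Measures and Phase Transitions*, 2nd ed., de Gruyter 2011,
Def. 1.23 (specification: proper, consistent `γ_{Λ'} γ_Λ = γ_{Λ'}` for `Λ ⊆ Λ'`), Rem. 1.24 (DLR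
`μ γ_Λ = μ`), formalised in the tree as `Literature.Probability.LatticeModels.IsSpecification` ∕
`IsGibbsMeasure` (junk-free set-wise forms) with the one-site laws
`DobrushinMetric.siteLaw γ x η = law of σ_x under γ_{x}(·|η)` (Föllmer 1988, Ch. I, §2.1).
[Presutti2009] E. Presutti, *Scaling Limits in Statistical Mechanics and Microstructures in Continuum
Mechanics*, Springer 2009, §3.2.2 «The setup» (p. 113): the data `(μ, μ', γ, γ', q)` of Dobrushin's
coupling construction — «`μ_{ω_(i)}` the conditional probability of `μ` given `ω_(i)`» and one-site
couplings `q` — formalised as `DobrushinCouplingCompact.OneSiteKernels μ μ' γ γ' q`, which asks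
that `μ`, `μ'` be invariant under resampling one coordinate from Markov kernels `γᵢ`, `γ'ᵢ` to the
single-spin space. [ConacheEtAl2015] D. Conache, Yu. Kondratiev, Yu. Kozitsky, T. Pasurek,
arXiv:1501.00673, Definition 2.1 ∕ 2.2 (5): one-site specifications `π = {π_ℓ}` and the set `ℳ(π)`
of `π`-consistent measures, `μ(A) = ∫ (∫ 𝟙_A(ξ × y_{ℓᶜ}) π_ℓ^y(dξ)) μ(dy)` — the same invariance.

THIS FILE is the bridge between the two vocabularies (no new mathematics):

* `siteKernel hγ x : Kernel (V → S) S` — the one-site law `η ↦ siteLaw γ x η` of a specification as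
  a Mathlib Markov kernel (measurability from `IsSpecification.measurable_fun`);
* `lintegral_update_siteKernel` — properness in functional form:
  `∫ F(η^{x←s}) γ_{x}(σ_x ∈ ds|η) = ∫ F dγ_{x}(·|η)` (`lintegral` version of the tree's
  `DobrushinMetric.siteAvg_eq_integral_siteLaw`);
* `lintegral_lintegral_update_siteKernel_spec` — for `x ∈ Λ'`, `γ_{Λ'}(·|η)` is invariant under
  resampling the spin at `x` from `γ_{x}` (properness + the tree's monadic consistency
  `IsSpecification.bind_consistent`) — what Lemma 3.8 of
  [ConacheEtAl2015] uses of `μ^x = μ(·|ℱ_{D_{N−1}})(x)` inside `D_{N−1}`;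
* `lintegral_lintegral_update_siteKernel` — a Gibbs measure `μ ∈ 𝒢(γ)` is invariant under
  resampling any spin from `γ_{x}` (DLR at `{x}` + properness): `μ ∈ ℳ(π)` for the one-site
  specification `π_x = siteLaw γ x` in the sense of [ConacheEtAl2015, Def. 2.2];
* `ae_eq_off` — properness restated with set-membership off `↑Λ`;
* ★ `oneSiteKernels_of_isGibbsMeasure` — for two specifications `γ, γ'`, Gibbs measures
  `μ ∈ 𝒢(γ)`, `μ' ∈ 𝒢(γ')` and measurable one-site couplings `q_x(η, η')` of `siteLaw γ x η` with
  `siteLaw γ' x η'`: `OneSiteKernels μ μ' (siteKernel hγ) (siteKernel hγ') q`; hence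
  `Presutti2009_thm_3_2_2_1_specification` (Presutti's Theorem 3.2.2.1 for two Gibbs measures on a
  finite site set with compact metric spins, via `Presutti2009_thm_3_2_2_1_compact`).

Everything is proved; one definition (`siteKernel`); no named facts; nothing model-specific.

## References
* [Georgii2011] Def. 1.23, Rem. 1.24.
* [Presutti2009] §3.2.2, Thm. 3.2.2.1 and «The setup», p. 113.
* [ConacheEtAl2015] arXiv:1501.00673, §2.1 Definitions 2.1–2.2, (5); §3.4 Lemma 3.8.
* H. Föllmer, *Random fields and diffusion processes*, LNM 1362 (1988), Ch. I, §2.1. [Follmer1988]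
-/

noncomputable section

open MeasureTheory ProbabilityTheory Function Finset

open scoped ENNReal NNReal BoundedContinuousFunction

namespace Literature.Probability.TransportMaps

namespace DobrushinCouplingSpecification

open Literature.MeasureTheory.OptimalTransport (IsCoupling)
open Literature.Probability.LatticeModels (Specification IsSpecification IsGibbsMeasure)
open Literature.Probability.LatticeModels.DobrushinMetric (siteLaw isProbabilityMeasure_siteLaw)
open DobrushinCouplingCompact (OneSiteKernels Presutti2009_thm_3_2_2_1_compact)

variable {V : Type*} {S : Type*} [MeasurableSpace S] {γ : Specification V S}

/-! ### The one-site kernels of a specification -/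

/-- **The one-site kernel of a specification at `x`**: `η ↦ siteLaw γ x η`, the law of the spin at
`x` under `γ_{x}(·|η)`, as a Mathlib kernel from configurations to the single-spin space
(`π_ℓ^x ∈ 𝒫(Ξ_ℓ)` of [ConacheEtAl2015, Def. 2.1]; Presutti's `γᵢ(·|ω)`).
[cite: ConacheEtAl2015, §2.1 Definition 2.1] -/
def siteKernel (hγ : IsSpecification γ) (x : V) : Kernel (V → S) S where
  toFun := siteLaw γ x
  measurable' := (Measure.measurable_map _ (measurable_pi_apply x)).comp (hγ.measurable_fun {x})

/-- `siteKernel hγ x η = siteLaw γ x η`. [cite: ConacheEtAl2015, §2.1 Definition 2.1] -/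
@[simp] theorem siteKernel_apply (hγ : IsSpecification γ) (x : V) (η : V → S) :
    siteKernel hγ x η = siteLaw γ x η := rfl

/-- The one-site kernels are Markov kernels. [cite: ConacheEtAl2015, §2.1 Definition 2.1] -/
instance isMarkovKernel_siteKernel (hγ : IsSpecification γ) (x : V) :
    IsMarkovKernel (siteKernel hγ x) :=
  ⟨fun η => isProbabilityMeasure_siteLaw hγ x η⟩

/-- **Properness, functional form** (`ℝ≥0∞`-valued): under `γ_{x}(·|η)` the configuration is `η`
off `x`, so `∫ F(η^{x←s}) (siteLaw γ x η)(ds) = ∫ F dγ_{x}(·|η)` (Föllmer 1988, Ch. I, §2.1: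
`π_{{k}}(η, ·) = π_k(·|η) × ∏_{i≠k} δ_{η(i)}`; the tree's `siteAvg_eq_integral_siteLaw` is the Bochner
form). [cite: Follmer1988, Ch. I (2.1)] -/
theorem lintegral_update_siteKernel [DecidableEq V] (hγ : IsSpecification γ) (x : V)
    {F : (V → S) → ℝ≥0∞} (hF : Measurable F) (η : V → S) :
    ∫⁻ s, F (update η x s) ∂(siteKernel hγ x η) = ∫⁻ σ, F σ ∂(γ {x} η) := by
  rw [siteKernel_apply, siteLaw, lintegral_map (f := fun s => F (update η x s))
    (hF.comp (measurable_update η)) (measurable_pi_apply x)]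
  refine lintegral_congr_ae ?_
  filter_upwards [hγ.proper {x} η] with σ hσ
  congr 1
  funext z
  by_cases hz : z = x
  · subst hz; simp
  · rw [update_of_ne hz]; exact (hσ z (by simpa using hz)).symm

/-- **`γ_{Λ'}(·|η)` is invariant under resampling a spin inside `Λ'` from the one-site kernel**:
for `x ∈ Λ'` and measurable `F ≥ 0`,
`∫∫ F(ω^{x←s}) (siteLaw γ x ω)(ds) γ_{Λ'}(dω|η) = ∫ F dγ_{Λ'}(·|η)` (properness + consistency
`γ_{Λ'} γ_{x} = γ_{Λ'}`). This is the consistency of `μ^x` inside `D_{N−1}` that Lemma 3.8 of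
Conache et al. uses (there `μ^x = μ(·|ℱ_{D_{N−1}})(x)`; for a Gibbs measure `γ_{D_{N−1}}(·|x)` is a
version). [cite: ConacheEtAl2015, §3.4 Lemma 3.8] -/
theorem lintegral_lintegral_update_siteKernel_spec [DecidableEq V] (hγ : IsSpecification γ)
    {Λ' : Finset V} {x : V} (hx : x ∈ Λ') (η : V → S) {F : (V → S) → ℝ≥0∞} (hF : Measurable F) :
    ∫⁻ ω, ∫⁻ s, F (update ω x s) ∂(siteKernel hγ x ω) ∂(γ Λ' η) = ∫⁻ ω, F ω ∂(γ Λ' η) := by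
  simp_rw [lintegral_update_siteKernel hγ x hF]
  rw [← Measure.lintegral_bind (hγ.measurable_fun {x}).aemeasurable hF.aemeasurable,
    hγ.bind_consistent (Finset.singleton_subset_iff.2 hx) η]

/-- **A Gibbs measure is invariant under one-site resampling**: for `μ ∈ 𝒢(γ)`, every site `x`
and measurable `F ≥ 0`, `∫∫ F(ω^{x←s}) (siteLaw γ x ω)(ds) μ(dω) = ∫ F dμ` (DLR at `{x}` +
properness) — i.e. `μ ∈ ℳ(π)` for the one-site specification `π_x = siteLaw γ x`,
[ConacheEtAl2015, Def. 2.2 (5)]. [cite: ConacheEtAl2015, §2.1 Definition 2.2 (5)] -/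
theorem lintegral_lintegral_update_siteKernel [DecidableEq V] (hγ : IsSpecification γ)
    {μ : Measure (V → S)} (hμ : IsGibbsMeasure γ μ) (x : V) {F : (V → S) → ℝ≥0∞}
    (hF : Measurable F) :
    ∫⁻ ω, ∫⁻ s, F (update ω x s) ∂(siteKernel hγ x ω) ∂μ = ∫⁻ ω, F ω ∂μ := by
  simp_rw [lintegral_update_siteKernel hγ x hF]
  rw [← Measure.lintegral_bind (hγ.measurable_fun {x}).aemeasurable hF.aemeasurable,
    hμ.bind_eq hγ {x}]

/-- **Properness off `↑Λ`**: `γ_Λ(·|η)`-a.e. configuration agrees with `η` at every site not in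
`Λ` (Georgii 2011, Def. 1.23 (ii)), with the exceptional sites read in `Set V`. [cite: Georgii2011, Def. 1.23] -/
theorem ae_eq_off (hγ : IsSpecification γ) (Λ : Finset V) (η : V → S) :
    ∀ᵐ σ ∂(γ Λ η), ∀ y, y ∉ (↑Λ : Set V) → σ y = η y := by
  filter_upwards [hγ.proper Λ η] with σ hσ y hy using hσ y (by simpa using hy)

/-! ### Presutti's setup for two Gibbs measures -/

/-- **`OneSiteKernels` for two DLR Gibbs measures.** For specifications `γ, γ'` with Gibbs
measures `μ ∈ 𝒢(γ)`, `μ' ∈ 𝒢(γ')` and Markov kernels `q_x(η, η')` on `S × S` coupling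
`siteLaw γ x η` with `siteLaw γ' x η'` (Presutti: «we suppose to have already found a "good"
coupling of such conditional probabilities»), the data `(μ, μ', siteKernel hγ, siteKernel hγ', q)`
satisfy `OneSiteKernels`. [cite: Presutti2009, §3.2.2 «The setup» (p. 113)] -/
theorem oneSiteKernels_of_isGibbsMeasure [DecidableEq V] {γ γ' : Specification V S}
    (hγ : IsSpecification γ) (hγ' : IsSpecification γ') {μ μ' : Measure (V → S)}
    (hμ : IsGibbsMeasure γ μ) (hμ' : IsGibbsMeasure γ' μ')
    {q : V → Kernel ((V → S) × (V → S)) (S × S)}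
    (hq : ∀ x p, (q x p).map Prod.fst = siteLaw γ x p.1)
    (hq' : ∀ x p, (q x p).map Prod.snd = siteLaw γ' x p.2) :
    OneSiteKernels μ μ' (siteKernel hγ) (siteKernel hγ') q :=
  ⟨fun x _ hF => lintegral_lintegral_update_siteKernel hγ hμ x hF,
    fun x _ hF => lintegral_lintegral_update_siteKernel hγ' hμ' x hF,
    fun x p => hq x p, fun x p => hq' x p⟩

/-- **Presutti 2009, Theorem 3.2.2.1, for two Gibbs measures of two specifications** on a finite
site set with a compact metric single-spin space: given measurable one-site couplings `qᵢ` of the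
one-site laws with `∫ dᵢ dqᵢ(ω, ω') ≤ Kᵢ(ω, ω')` (bounded continuous `dᵢ, Kᵢ ≥ 0`), there is a
coupling `Q` of `μ ∈ 𝒢(γ)` and `μ' ∈ 𝒢(γ')` with `∫ dᵢ(ωᵢ, ω'ᵢ) dQ ≤ ∫ Kᵢ dQ` for every `i`
(«local bounds can be made global»). [cite: Presutti2009, §3.2.2 Thm. 3.2.2.1] -/
theorem Presutti2009_thm_3_2_2_1_specification [Fintype V] [DecidableEq V] [Nonempty V]
    [MetricSpace S] [CompactSpace S] [BorelSpace S] {γ γ' : Specification V S}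
    (hγ : IsSpecification γ) (hγ' : IsSpecification γ') {μ μ' : Measure (V → S)}
    (hμ : IsGibbsMeasure γ μ) (hμ' : IsGibbsMeasure γ' μ')
    {q : V → Kernel ((V → S) × (V → S)) (S × S)} [∀ i, IsMarkovKernel (q i)]
    (hq : ∀ x p, (q x p).map Prod.fst = siteLaw γ x p.1)
    (hq' : ∀ x p, (q x p).map Prod.snd = siteLaw γ' x p.2)
    (d : V → (S × S) →ᵇ ℝ≥0) (K : V → ((V → S) × (V → S)) →ᵇ ℝ≥0)
    (hdK : ∀ i p, ∫⁻ s, (d i s : ℝ≥0∞) ∂(q i p) ≤ K i p) :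
    ∃ Q : Measure ((V → S) × (V → S)), IsProbabilityMeasure Q ∧ IsCoupling μ μ' Q ∧
      ∀ i, ∫⁻ x, (d i (x.1 i, x.2 i) : ℝ≥0∞) ∂Q ≤ ∫⁻ x, (K i x : ℝ≥0∞) ∂Q := by
  haveI := hμ.isProbabilityMeasure
  haveI := hμ'.isProbabilityMeasure
  exact Presutti2009_thm_3_2_2_1_compact (oneSiteKernels_of_isGibbsMeasure hγ hγ' hμ hμ' hq hq')
    d K hdK

end DobrushinCouplingSpecification

end Literature.Probability.TransportMaps
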